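import Summits.ResolutionOfSingularities.ResolutionOfSingularities.Theorems.LossEntryW33
import Summits.ResolutionOfSingularities.ResolutionOfSingularities.Theorems.MaxContactCutWallCut
import Summits.ResolutionOfSingularities.ResolutionOfSingularities.Theorems.NearCutPrimeShedding
import Summits.ResolutionOfSingularities.ResolutionOfSingularities.Theorems.ProximityCutArcLaw
import Summits.ResolutionOfSingularities.ResolutionOfSingularities.Theorems.PlanarGhostDescent
import Summits.ResolutionOfSingularities.ResolutionOfSingularities.Theorems.TowerDictionaryHoldsC
import HarnessLib

/-!
# LossEntryW34 — BOOKING after the lossy cell (decomp-res lens-3 g29, node «LossEntryWalk», part W34)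

`LossEntryW33.lean` proves, hypothesis-free, `LossEpisode.noLossyStrictTailsDeep : WallCut.NoLossyStrictTailsDeep`
(the LOSSY class of the exact split `WallCut.smallDeadStrict_iff_lossy_tame_wild` of the column's residual item
`FreezeCut.NoSmallDeadStrictHighSkewJointTailsDeep`).  This short file does the bookkeeping BY NAME, combining it with
the tree's other hypothesis-free decisions `ProximityCut.noFreePointTailsDeep_holds` and
`GhostDescent.noHighPlanarJointTailsDeep_holds`:

* **hypothesis-free exact re-location** of the residual: `smallDeadStrict_iff_tame_wild :
  NoSmallDeadStrictHighSkewJointTailsDeep ↔ NoTameBalancedStrictTailsDeep ∧ NoWildBalancedStrictTailsDeep` — only the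
  two δ-BALANCED strict classes remain;
* modulo the balanced-wall port (`WallCut.BalancedWallPort`, g21) the residual, the high-skew class, lens-5's skew
  coefficient class, lens-5's monomial-regime class AND the host aside `MaxContactCut.DefectWalksDeep` are each
  EQUIVALENT to the single WILD balanced strict class `NoWildBalancedStrictTailsDeep` (`*_iff_wild_of_port`);
* modulo the near-chain port alone (`NearCut.NearChainPort`, g23; CJS LNM 2270 Thm 5.40 `B = ∅`) the residual
  `NoSmallDeadStrictHighSkewJointTailsDeep`, the host aside `MaxContactCut.DefectWalksDeep` and the route item
  `MaxContactCut.PolyPureTowersDeep` all HOLD (`*_of_nearChainPort`).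

All proofs are one-line compositions of landed theorems; standard axioms only.
-/

namespace Summit.ResolutionOfSingularities.ResolutionOfSingularities.Theorems.WallCut

open Summit.ResolutionOfSingularities.ResolutionOfSingularities.Theses
open Summit.ResolutionOfSingularities.ResolutionOfSingularities.Theorems.FreezeCut
open Summit.ResolutionOfSingularities.ResolutionOfSingularities.Theorems.NearCut

/-- **EXACT RE-LOCATION, hypothesis-free, after the lossy cell:** the column's residual
`NoSmallDeadStrictHighSkewJointTailsDeep` is EQUIVALENT to the conjunction of the two δ-balanced strict classes.
[new; KERNEL] [folklore] -/
theorem smallDeadStrict_iff_tame_wild :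
    NoSmallDeadStrictHighSkewJointTailsDeep ↔ NoTameBalancedStrictTailsDeep ∧ NoWildBalancedStrictTailsDeep :=
  smallDeadStrict_iff_lossy_tame_wild.trans
    ⟨fun h => h.2, fun h => ⟨LossEpisode.noLossyStrictTailsDeep, h⟩⟩

/-- The residual modulo the balanced-wall port is EXACTLY the wild balanced strict class. [new] [folklore] -/
theorem smallDeadStrict_iff_wild_of_port (hπ : BalancedWallPort) :
    NoSmallDeadStrictHighSkewJointTailsDeep ↔ NoWildBalancedStrictTailsDeep :=
  (smallDeadStrict_iff_lossy_wild_of_port hπ).trans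
    ⟨fun h => h.2, fun h => ⟨LossEpisode.noLossyStrictTailsDeep, h⟩⟩

/-- The high-skew joint class modulo the balanced-wall port is EXACTLY the wild balanced strict class. [new]
[folklore] -/
theorem highSkew_iff_wild_of_port (hπ : BalancedWallPort) :
    NoHighSkewJointTailsDeep ↔ NoWildBalancedStrictTailsDeep :=
  (highSkew_iff_lossy_wild_of_port hπ).trans ⟨fun h => h.2, fun h => ⟨LossEpisode.noLossyStrictTailsDeep, h⟩⟩

/-- lens-5's skew coefficient class modulo the balanced-wall port is EXACTLY the wild balanced strict class. [new]
[folklore] -/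
theorem skew_iff_wild_of_port (hπ : BalancedWallPort) :
    CoefficientCut.NoSkewJointTailsDeep ↔ NoWildBalancedStrictTailsDeep :=
  (skew_iff_lossy_wild_of_port hπ).trans ⟨fun h => h.2, fun h => ⟨LossEpisode.noLossyStrictTailsDeep, h⟩⟩

/-- lens-5's monomial-regime class modulo the balanced-wall port is EXACTLY the wild balanced strict class. [new]
[folklore] -/
theorem monomialRegime_iff_wild_of_port (hπ : BalancedWallPort) :
    StallVertex.NoMonomialRegimeSkewStalledTailsDeep ↔ NoWildBalancedStrictTailsDeep :=
  (monomialRegime_iff_lossy_wild_of_port hπ).trans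
    ⟨fun h => h.2, fun h => ⟨LossEpisode.noLossyStrictTailsDeep, h⟩⟩

/-- **The HOST ASIDE `MaxContactCut.DefectWalksDeep` modulo the balanced-wall port is EXACTLY the wild balanced strict
class** (free-point tails, high planar joint tails and lossy strict tails are all decided in the tree). [new]
[folklore] -/
theorem defectWalksDeep_iff_wild_of_port (hπ : BalancedWallPort) :
    MaxContactCut.DefectWalksDeep ↔ NoWildBalancedStrictTailsDeep :=
  (defectWalksDeep_iff_of_port hπ).trans
    ⟨fun h => h.2.2.2, fun h =>
      ⟨ProximityCut.noFreePointTailsDeep_holds, GhostDescent.noHighPlanarJointTailsDeep_holds,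
        LossEpisode.noLossyStrictTailsDeep, h⟩⟩

/-- **The column's residual item HOLDS modulo the near-chain port alone.** [new] [folklore] -/
theorem noSmallDeadStrictHighSkewJointTailsDeep_of_nearChainPort (hP : NearChainPort) :
    NoSmallDeadStrictHighSkewJointTailsDeep :=
  smallDeadStrict_iff_tame_wild.mpr
    ⟨noTameBalancedStrictTails_of_nearChainPort hP, noWildBalancedStrictTails_of_nearChainPort hP⟩

/-- **The HOST ASIDE `MaxContactCut.DefectWalksDeep` HOLDS modulo the near-chain port alone.** [new] [folklore] -/
theorem defectWalksDeep_of_nearChainPort (hP : NearChainPort) : MaxContactCut.DefectWalksDeep :=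
  (defectWalksDeep_iff_of_nearChainPort hP).mpr
    ⟨ProximityCut.noFreePointTailsDeep_holds, GhostDescent.noHighPlanarJointTailsDeep_holds,
      LossEpisode.noLossyStrictTailsDeep⟩

/-- **The route item `MaxContactCut.PolyPureTowersDeep` HOLDS modulo the near-chain port alone** (tower dictionary is
a theorem, `TowerDictionaryHolds.towerDictionary_holds`). [new] [folklore] -/
theorem polyPureTowersDeep_of_nearChainPort (hP : NearChainPort) : MaxContactCut.PolyPureTowersDeep :=
  TowerDictionaryHolds.polyPureTowersDeep_of_defectWalksDeep (defectWalksDeep_of_nearChainPort hP)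

end Summit.ResolutionOfSingularities.ResolutionOfSingularities.Theorems.WallCut
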